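import Literature.Geometry.Riemannian.BamlerGradientEstimate
import Literature.Geometry.Riemannian.HeatKernelMeasures
import Literature.Geometry.Riemannian.GradientEstimateIntegration
import HarnessLib

/-!
# Bamler's gradient estimate for the heat kernel measures of a Ricci flow, and the Lipschitz
# bounds it yields (Bamler 2020a, Thm. 4.1; Bamler 2023, §3.7, Def. 3.2 (6))

R. Bamler, *Entropy and heat kernel bounds on a Ricci flow background*, arXiv:2008.07093 (2020a),
Thm. 4.1, is in the tree for smooth solutions `u ∈ C^∞(M × [0, T'])` of the heat equation of a
Ricci flow on a closed manifold (`IsRicciFlow.bamler_gradientEstimate`). This file runs it on the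
solution operator, i.e. on the functions `x ↦ ∫ u₀ dν_{x,r;s}` (`ν_{x,r;s}` the heat kernel
measures of `HeatKernelMeasures.lean`), for a `C^∞` family `h` of Riemannian metrics on a closed manifold `M` (modelled on `ℝᵐ`) which is
a Ricci flow on `[s, t]`, and converts the resulting bounds on `|∇ ·|²` into Lipschitz bounds
for the Riemannian distance `d_{h(r)}` (`PseudoRiemannianMetric.edist`, `RiemannianDistance.lean`)
— the form in which item (6) of the definition of a metric flow (R. Bamler, *Compactness theory of
the space of super Ricci flows*, Invent. Math. 233 (2023), Def. 3.2) and the continuity of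
`x ↦ ν_{x,r;s}` consume Theorem 4.1:

* `ofReal_abs_sub_le_of_gradSq_le` — **`|∇f|² ≤ L²` implies `|f x − f y| ≤ L d(x, y)`** for a
  `C¹` function on a manifold with a Riemannian metric (integration along `C¹` paths,
  `ofReal_abs_sub_le_mul_riemEDist`; points at infinite distance impose nothing);
* `integral_heatKernelMeasure_mem_Icc`, `contMDiff_integral_heatKernelMeasure` — the propagation
  `x ↦ ∫ u₀ dν_{x,r;s}` of smooth data stays between the extrema of `u₀` and is `C^∞`;
* `IsRicciFlow.gradSq_PhiInv_integral_heatKernelMeasure_le` — **Theorem 4.1 for the heat kernel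
  measures**: if `u₀ : M → (0, 1)` is smooth with `T |∇(Φ⁻¹ ∘ u₀)|²_{h(s)} ≤ 1`, `T ≥ 0`, then
  `(T + r − s) |∇(Φ⁻¹ ∘ ∫ u₀ dν_{·,r;s})|²_{h(r)} ≤ 1` for `r ∈ [s, t]`; the case `T = 0`
  (`…_le_inv`) needs no hypothesis at time `s`;
* `IsRicciFlow.ofReal_abs_PhiInv_sub_PhiInv_le` — the same as a Lipschitz bound:
  `Φ⁻¹ ∘ ∫ u₀ dν_{·,r;s}` is `(T + r − s)^{-1/2}`-Lipschitz for `d_{h(r)}`;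
* `IsRicciFlow.ofReal_abs_integral_sub_integral_le` — **the gradient bound behind the strong
  Feller property**: for smooth `φ` with `|φ| ≤ B`,
  `|∫ φ dν_{x,r;s} − ∫ φ dν_{y,r;s}| ≤ B (π (r − s))^{-1/2} d_{h(r)}(x, y)` (`s < r ≤ t`), from the
  previous item at `T = 0` applied to `(φ + B')/(2B')`, `B' > B`, and the Lipschitz constant
  `(4π)^{-1/2}` of `Φ`.

Everything is proved; no definitions, no named facts. The passage to Lipschitz (`T > 0`) and to
bounded measurable (`T = 0`) initial data — the two halves of Def. 3.2 (6) for the metric flow of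
a Ricci flow — is done in the sequel files.

## References

* R. H. Bamler, *Entropy and heat kernel bounds on a Ricci flow background*, arXiv:2008.07093
  (2020), §4.1, Thm. 4.1. [Bamler2020Entropy]
* R. H. Bamler, *Compactness theory of the space of super Ricci flows*, Invent. Math. 233 (2023),
  1121–1277, §3.1 Def. 3.2 (6), §3.7. [Bamler2023]
-/

noncomputable section

open Bundle Set Function Filter Manifold MeasureTheory Measure TopologicalSpace
open scoped Manifold ContDiff Topology ENNReal NNReal

namespace Literature.Geometry.Riemannian

open Lorentzian Lorentzian.PseudoRiemannianMetric MetricFlow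

/-! ### From a gradient bound to a Lipschitz bound -/

section LipschitzOfGradSq

variable {E : Type*} [NormedAddCommGroup E] [NormedSpace ℝ E] [FiniteDimensional ℝ E]
  {H : Type*} [TopologicalSpace H] {I : ModelWithCorners ℝ E H}
  {M : Type*} [TopologicalSpace M] [ChartedSpace H M] [IsManifold I ∞ M]

/-- **A gradient bound is a Lipschitz bound.** If `f` is `C¹` on a manifold with a Riemannian
metric `g` and `|∇f|²_g ≤ L²` everywhere, `L > 0`, then `|f x − f y| ≤ L · d_g(x, y)` for all
`x, y` (stated in `ℝ≥0∞`, so that points at infinite distance impose nothing): Cauchy–Schwarz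
`|df(v)| ≤ |∇f| |v|` and integration along the `C¹` paths competing in `d_g`
(`ofReal_abs_sub_le_mul_riemEDist`). [folklore] -/
theorem ofReal_abs_sub_le_of_gradSq_le
    (g : PseudoRiemannianMetric I ∞ E (TangentSpace I : M → Type _)) (hg : g.IsRiemannian)
    {f : M → ℝ} (hf : ContMDiff I 𝓘(ℝ, ℝ) 1 f) {L : ℝ} (hL : 0 < L)
    (hgrad : ∀ x, g.gradSq f x ≤ L ^ 2) (x y : M) :
    ENNReal.ofReal |f x - f y| ≤ ENNReal.ofReal L * g.edist hg x y := by
  have hdf : ∀ z ∈ (univ : Set M), ∀ v : TangentSpace I z,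
      |mvfderiv I f z v| ≤ (L.toNNReal : ℝ≥0) * Real.sqrt (g.val z v v) := by
    intro z _ v
    have h2 : Real.sqrt (g.gradSq f z) ≤ L := by
      rw [← Real.sqrt_sq hL.le]
      exact Real.sqrt_le_sqrt (hgrad z)
    rw [show ((L.toNNReal : ℝ≥0) : ℝ) = L from Real.coe_toNNReal L hL.le]
    exact (abs_mvfderiv_le_sqrt_gradSq_mul_sqrt g hg f z v).trans
      (mul_le_mul_of_nonneg_right h2 (Real.sqrt_nonneg _))
  by_cases hxy : g.riemEDist x y < ⊤
  · have key := ofReal_abs_sub_le_mul_riemEDist g hg isOpen_univ hf.contMDiffOn hdf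
      (x := x) (ρ := ⊤) (subset_univ _) (y := y) (by rwa [PseudoRiemannianMetric.mem_ball])
    rwa [PseudoRiemannianMetric.riemEDist_eq hg] at key
  · rw [PseudoRiemannianMetric.riemEDist_eq hg, not_lt, top_le_iff] at hxy
    rw [hxy, ENNReal.mul_top (by simpa using hL)]
    exact le_top

end LipschitzOfGradSq

/-! ### The propagation of smooth data: range and smoothness -/

section HeatKernel

variable {m : ℕ} {H : Type*} [TopologicalSpace H]
  {I : ModelWithCorners ℝ (EuclideanSpace ℝ (Fin m)) H} [I.Boundaryless]
  {M : Type*} [TopologicalSpace M] [ChartedSpace H M] [IsManifold I ∞ M]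
  [T2Space M] [CompactSpace M] [SecondCountableTopology M] [MeasurableSpace M] [BorelSpace M]
  {h : ℝ → PseudoRiemannianMetric I ∞ (EuclideanSpace ℝ (Fin m)) (TangentSpace I : M → Type _)}
  (hh : IsContMDiffFamilyOn ∞ h univ) (hR : ∀ r, (h r).IsRiemannian)

/-- **The propagation of continuous data stays within its bounds**: if `a ≤ φ ≤ b` then
`a ≤ ∫ φ dν_{x,r;s} ≤ b` (the heat kernel measures are probability measures). [folklore] -/
theorem integral_heatKernelMeasure_mem_Icc (r : ℝ) (x : M) (s : ℝ) {φ : M → ℝ}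
    (hφ : Continuous φ) {a b : ℝ} (ha : ∀ y, a ≤ φ y) (hb : ∀ y, φ y ≤ b) :
    ∫ y, φ y ∂(heatKernelMeasure hh hR r x s) ∈ Icc a b := by
  set ν := heatKernelMeasure hh hR r x s
  have hφi : Integrable φ ν := hφ.integrable_of_hasCompactSupport (HasCompactSupport.of_compactSpace φ)
  refine ⟨?_, ?_⟩
  · simpa [ν] using integral_mono (integrable_const a) hφi ha
  · simpa [ν] using integral_mono hφi (integrable_const b) hb

/-- **The propagation of smooth data is smooth**: for `C^∞` data `u₀`, the function
`x ↦ ∫ u₀ dν_{x,r;s}` is `C^∞` (it is the time-`r` slice `P_{s→r}u₀` of the smooth heat solution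
for `s < r`, and `u₀` itself for `r ≤ s`). [cite: Bamler2020Entropy, §2.3] -/
theorem contMDiff_integral_heatKernelMeasure (r s : ℝ) {u₀ : M → ℝ}
    (hu₀ : ContMDiff I 𝓘(ℝ, ℝ) ∞ u₀) :
    ContMDiff I 𝓘(ℝ, ℝ) ∞ fun x ↦ ∫ y, u₀ y ∂(heatKernelMeasure hh hR r x s) := by
  rcases le_or_gt r s with hrs | hsr
  · simp only [heatKernelMeasure_of_le hh hR hrs, integral_dirac]
    exact hu₀
  · simp only [integral_heatKernelMeasure_eq_heatValue hh hR hsr _ hu₀]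
    exact contMDiff_heatValue hh hR hu₀

omit [T2Space M] [SecondCountableTopology M] [MeasurableSpace M] [BorelSpace M] in
/-- A continuous function on a compact space with values in `(0, 1)` takes values in a compact
subinterval `[a, b] ⊂ (0, 1)`. [folklore] -/
theorem exists_Icc_subset_Ioo_of_continuous {φ : M → ℝ} (hφ : Continuous φ)
    (h01 : ∀ x, φ x ∈ Ioo (0 : ℝ) 1) :
    ∃ a b : ℝ, 0 < a ∧ b < 1 ∧ ∀ x, φ x ∈ Icc a b := by
  cases isEmpty_or_nonempty M with
  | inl hM => exact ⟨1 / 2, 1 / 2, by norm_num, by norm_num, fun x ↦ (IsEmpty.false x).elim⟩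
  | inr hM =>
    obtain ⟨x₀, -, hx₀⟩ := isCompact_univ.exists_isMinOn univ_nonempty hφ.continuousOn
    obtain ⟨x₁, -, hx₁⟩ := isCompact_univ.exists_isMaxOn univ_nonempty hφ.continuousOn
    exact ⟨φ x₀, φ x₁, (h01 x₀).1, (h01 x₁).2, fun x ↦ ⟨hx₀ (mem_univ x), hx₁ (mem_univ x)⟩⟩

/-! ### Theorem 4.1 for the heat kernel measures -/

/-- **Bamler 2020a, Theorem 4.1, for the heat kernel measures.** Let `h` be a `C^∞` family of
Riemannian metrics on the closed manifold `M` which is a Ricci flow on `[s, t]`, `s < t`, and let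
`u₀ : M → (0, 1)` be smooth with `T |∇(Φ⁻¹ ∘ u₀)|²_{h(s)} ≤ 1` for some `T ≥ 0`. Then for every
`r ∈ [s, t]`

  `(T + (r − s)) · |∇(Φ⁻¹ ∘ (x ↦ ∫ u₀ dν_{x,r;s}))|²_{h(r)} ≤ 1`

("`|∇ Φ⁻¹_{T+t−t₀}(u_t)| ≤ 1`" for the solution `u_r(x) = ∫ u₀ dν_{x,r;s}` of the heat equation
with `u_s = u₀`). Proof: the smooth solution `w` from `u₀` on `M × [s, t]`
(`exists_isHeatSolutionOn`) takes values in `(0, 1)` (comparison with the constants `min u₀ > 0`,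
`max u₀ < 1`), represents the propagation (`w(r, x) = ∫ u₀ dν_{x,r;s}`), and after the time
translation `τ = r − s` is subject to `IsRicciFlow.bamler_gradientEstimate` on `[0, t − s]`.
[cite: Bamler2020Entropy, §4.1, Thm. 4.1] -/
theorem IsRicciFlow.gradSq_PhiInv_integral_heatKernelMeasure_le {s t : ℝ} (hst : s < t)
    {cov : ℝ → CovariantDerivative I (EuclideanSpace ℝ (Fin m)) (TangentSpace I : M → Type _)}
    (hflow : IsRicciFlow h cov (Icc s t))
    {u₀ : M → ℝ} (hu₀ : ContMDiff I 𝓘(ℝ, ℝ) ∞ u₀) (h01 : ∀ x, u₀ x ∈ Ioo (0 : ℝ) 1)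
    {T : ℝ} (hT : 0 ≤ T) (hT0 : ∀ x, T * (h s).gradSq (fun y ↦ PhiInv (u₀ y)) x ≤ 1)
    {r : ℝ} (hr : r ∈ Icc s t) (x : M) :
    (T + (r - s)) *
        (h r).gradSq (fun y ↦ PhiInv (∫ z, u₀ z ∂(heatKernelMeasure hh hR r y s))) x ≤ 1 := by
  -- the smooth solution from `u₀` and its range
  obtain ⟨w, hw, hws⟩ := exists_isHeatSolutionOn hh hR hst hu₀
  obtain ⟨a, b, ha, hb, hab⟩ := exists_Icc_subset_Ioo_of_continuous hu₀.continuous h01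
  have hwa : ∀ r' ∈ Icc s t, ∀ y, a ≤ w r' y := fun r' hr' y ↦
    (isHeatSolutionOn_const (h := h) a s t).le_of_le_initial hR hst hw
      (fun z ↦ by rw [hws]; exact (hab z).1) hr' y
  have hwb : ∀ r' ∈ Icc s t, ∀ y, w r' y ≤ b := fun r' hr' y ↦
    hw.le_of_le_initial hR hst (isHeatSolutionOn_const (h := h) b s t)
      (fun z ↦ by rw [hws]; exact (hab z).2) hr' y
  have hw01 : ∀ r' ∈ Icc s t, ∀ y, w r' y ∈ Ioo (0 : ℝ) 1 := fun r' hr' y ↦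
    ⟨ha.trans_le (hwa r' hr' y), (hwb r' hr' y).trans_lt hb⟩
  -- the representation formula `w(r', y) = ∫ u₀ dν_{y,r';s}`
  have hrep : ∀ r' ∈ Icc s t, ∀ y, ∫ z, u₀ z ∂(heatKernelMeasure hh hR r' y s) = w r' y := by
    intro r' hr' y
    rcases hr'.1.eq_or_lt with hsr' | hsr'
    · subst hsr'
      rw [heatKernelMeasure_self hh hR, integral_dirac, hws]
    · rw [(hw.mono le_rfl hr'.2).eq_integral_heatKernelMeasure hh hR hsr' y, hws]
  have hfun : (fun y ↦ PhiInv (∫ z, u₀ z ∂(heatKernelMeasure hh hR r y s))) =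
      fun y ↦ PhiInv (w r y) := by
    funext y
    rw [hrep r hr y]
  rw [hfun]
  -- time translation to `[0, t - s]`
  have hflow' : IsRicciFlow (fun τ ↦ h (τ + s)) (fun τ ↦ cov (τ + s)) (Icc 0 (t - s)) := by
    refine (hflow.comp_add_const s).mono fun τ hτ ↦ ?_
    show τ + s ∈ Icc s t
    exact ⟨by linarith [hτ.1], by linarith [hτ.2]⟩
  have hR' : ∀ τ ∈ Icc (0 : ℝ) (t - s), (h (τ + s)).IsRiemannian := fun τ _ ↦ hR _
  have hw' := hw.comp_add_const s
  simp only [sub_self] at hw'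
  have hu01' : ∀ τ ∈ Icc (0 : ℝ) (t - s), ∀ y, w (τ + s) y ∈ Ioo (0 : ℝ) 1 := fun τ hτ y ↦
    hw01 (τ + s) ⟨by linarith [hτ.1], by linarith [hτ.2]⟩ y
  have hT0' : ∀ y, T * (h (0 + s)).gradSq (fun z ↦ PhiInv (w (0 + s) z)) y ≤ 1 := by
    intro y
    simpa only [zero_add, hws] using hT0 y
  have key := hflow'.bamler_gradientEstimate (sub_pos.2 hst) hR' hw'.1 hu01' hw'.2 hT hT0'
    (r - s) ⟨by linarith [hr.1], by linarith [hr.2]⟩ x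
  simpa only [sub_add_cancel] using key

/-- **Theorem 4.1 with `T = 0`**: for smooth `u₀ : M → (0, 1)` and `r ∈ [s, t]`,
`(r − s) |∇(Φ⁻¹ ∘ ∫ u₀ dν_{·,r;s})|²_{h(r)} ≤ 1`, with no hypothesis at time `s`.
[cite: Bamler2020Entropy, §4.1, Thm. 4.1] -/
theorem IsRicciFlow.gradSq_PhiInv_integral_heatKernelMeasure_le_inv {s t : ℝ} (hst : s < t)
    {cov : ℝ → CovariantDerivative I (EuclideanSpace ℝ (Fin m)) (TangentSpace I : M → Type _)}
    (hflow : IsRicciFlow h cov (Icc s t))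
    {u₀ : M → ℝ} (hu₀ : ContMDiff I 𝓘(ℝ, ℝ) ∞ u₀) (h01 : ∀ x, u₀ x ∈ Ioo (0 : ℝ) 1)
    {r : ℝ} (hr : r ∈ Icc s t) (x : M) :
    (r - s) * (h r).gradSq (fun y ↦ PhiInv (∫ z, u₀ z ∂(heatKernelMeasure hh hR r y s))) x ≤ 1 := by
  have key := hflow.gradSq_PhiInv_integral_heatKernelMeasure_le hh hR hst hu₀ h01 le_rfl
    (fun y ↦ by simp) hr x
  simpa only [zero_add] using key

/-! ### Lipschitz forms -/

/-- `Φ⁻¹ ∘ (x ↦ ∫ u₀ dν_{x,r;s})` is `C^∞` for smooth `u₀ : M → (0, 1)` (the propagation stays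
in `[min u₀, max u₀] ⊂ (0, 1)`, where `Φ⁻¹` is smooth). [folklore] -/
theorem contMDiff_PhiInv_integral_heatKernelMeasure (r s : ℝ) {u₀ : M → ℝ}
    (hu₀ : ContMDiff I 𝓘(ℝ, ℝ) ∞ u₀) (h01 : ∀ x, u₀ x ∈ Ioo (0 : ℝ) 1) :
    ContMDiff I 𝓘(ℝ, ℝ) ∞ fun x ↦ PhiInv (∫ z, u₀ z ∂(heatKernelMeasure hh hR r x s)) := by
  obtain ⟨a, b, ha, hb, hab⟩ := exists_Icc_subset_Ioo_of_continuous hu₀.continuous h01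
  intro x
  have hx := integral_heatKernelMeasure_mem_Icc hh hR r x s hu₀.continuous
    (fun y ↦ (hab y).1) (fun y ↦ (hab y).2)
  have hPhi : ContDiffAt ℝ ∞ PhiInv (∫ z, u₀ z ∂(heatKernelMeasure hh hR r x s)) := by
    have := contDiffAt_PhiInv (PhiInv (∫ z, u₀ z ∂(heatKernelMeasure hh hR r x s)))
    rwa [Phi_PhiInv (ha.trans_le hx.1) (hx.2.trans_lt hb)] at this
  exact ContDiffAt.comp_contMDiffAt (g := PhiInv)
    (f := fun x' ↦ ∫ z, u₀ z ∂(heatKernelMeasure hh hR r x' s)) hPhi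
    (contMDiff_integral_heatKernelMeasure hh hR r s hu₀ x)

/-- **Theorem 4.1 as a Lipschitz bound.** Under the hypotheses of
`IsRicciFlow.gradSq_PhiInv_integral_heatKernelMeasure_le`, if `T + (r − s) > 0` then
`f' = Φ⁻¹ ∘ (x ↦ ∫ u₀ dν_{x,r;s})` is `(T + r − s)^{-1/2}`-Lipschitz for the Riemannian distance
of `h(r)`: `|f' x − f' y| ≤ (T + r − s)^{-1/2} d_{h(r)}(x, y)` — the form of Bamler 2023,
Def. 3.2 (6) ("`Φ⁻¹ ∘ u_t` is `(t − s + T)^{-1/2}`-Lipschitz"). [cite: Bamler2023, §3.1, Def. 3.2 (6)] -/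
theorem IsRicciFlow.ofReal_abs_PhiInv_sub_PhiInv_le {s t : ℝ} (hst : s < t)
    {cov : ℝ → CovariantDerivative I (EuclideanSpace ℝ (Fin m)) (TangentSpace I : M → Type _)}
    (hflow : IsRicciFlow h cov (Icc s t))
    {u₀ : M → ℝ} (hu₀ : ContMDiff I 𝓘(ℝ, ℝ) ∞ u₀) (h01 : ∀ x, u₀ x ∈ Ioo (0 : ℝ) 1)
    {T : ℝ} (hT : 0 ≤ T) (hT0 : ∀ x, T * (h s).gradSq (fun y ↦ PhiInv (u₀ y)) x ≤ 1)
    {r : ℝ} (hr : r ∈ Icc s t) (hTr : 0 < T + (r - s)) (x y : M) :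
    ENNReal.ofReal |PhiInv (∫ z, u₀ z ∂(heatKernelMeasure hh hR r x s)) -
        PhiInv (∫ z, u₀ z ∂(heatKernelMeasure hh hR r y s))| ≤
      ENNReal.ofReal (1 / Real.sqrt (T + (r - s))) * (h r).edist (hR r) x y := by
  refine ofReal_abs_sub_le_of_gradSq_le (h r) (hR r)
    ((contMDiff_PhiInv_integral_heatKernelMeasure hh hR r s hu₀ h01).of_le
      (WithTop.coe_le_coe.mpr le_top))
    (one_div_pos.2 (Real.sqrt_pos.2 hTr)) (fun z ↦ ?_) x y
  have key := hflow.gradSq_PhiInv_integral_heatKernelMeasure_le hh hR hst hu₀ h01 hT hT0 hr z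
  rw [div_pow, one_pow, Real.sq_sqrt hTr.le, le_div_iff₀ hTr, mul_comm]
  simpa only [one_mul] using key

/-- Elementary: if `|c| ≤ B' κ d` for every `B' > B ≥ 0`, with `κ ≥ 0` and `d ∈ ℝ≥0∞`, in the
extended form `ofReal |c| ≤ ofReal (B' κ) * d`, then `ofReal |c| ≤ ofReal (B κ) * d` provided
`B κ > 0`. [folklore] -/
theorem ofReal_abs_le_of_forall_gt {c B κ : ℝ} {d : ℝ≥0∞} (hBκ : 0 < B * κ) (hκ : 0 ≤ κ)
    (h : ∀ B', B < B' → ENNReal.ofReal |c| ≤ ENNReal.ofReal (B' * κ) * d) :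
    ENNReal.ofReal |c| ≤ ENNReal.ofReal (B * κ) * d := by
  rcases eq_or_ne d ⊤ with hd | hd
  · rw [hd, ENNReal.mul_top (by simpa using hBκ)]
    exact le_top
  have hB : 0 < B := pos_of_mul_pos_left hBκ hκ
  -- reduce to a real inequality
  have hreal : ∀ B', B < B' → |c| ≤ B' * κ * d.toReal := by
    intro B' hB'
    have h1 := h B' hB'
    rw [← ENNReal.ofReal_toReal hd, ← ENNReal.ofReal_mul' ENNReal.toReal_nonneg] at h1
    have : 0 ≤ B' * κ := mul_nonneg (hB.trans hB').le hκ
    exact (ENNReal.ofReal_le_ofReal_iff (by positivity)).1 h1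
  have hle : |c| ≤ B * κ * d.toReal := by
    refine le_of_forall_gt_imp_ge_of_dense fun q hq ↦ ?_
    rcases eq_or_lt_of_le (ENNReal.toReal_nonneg : 0 ≤ d.toReal) with hd0 | hd0
    · -- `d.toReal = 0`: use any `B' > B`
      have := hreal (B + 1) (lt_add_one B)
      rw [← hd0, mul_zero] at this hq
      exact this.trans hq.le
    · -- choose `B'` with `B' κ d = q`
      have hκ0 : 0 < κ := lt_of_le_of_ne hκ (by rintro rfl; simp at hBκ)
      set B' := q / (κ * d.toReal) with hB'
      have hB'gt : B < B' := by
        rw [hB', lt_div_iff₀ (mul_pos hκ0 hd0)]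
        nlinarith
      have := hreal B' hB'gt
      rwa [hB', div_mul_eq_mul_div, div_mul_eq_mul_div, mul_assoc,
        mul_div_assoc, div_self (mul_pos hκ0 hd0).ne', mul_one] at this
  calc ENNReal.ofReal |c| ≤ ENNReal.ofReal (B * κ * d.toReal) := ENNReal.ofReal_le_ofReal hle
    _ = ENNReal.ofReal (B * κ) * d := by
      rw [ENNReal.ofReal_mul' ENNReal.toReal_nonneg, ENNReal.ofReal_toReal hd]

/-- **The Lipschitz bound behind the strong Feller property** (consequence of Theorem 4.1 at
`T = 0`, as in Bamler 2023, §3.7 / the remark after Def. 3.2 that `y ↦ ν_{y;s}(S)` is continuous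
for `s < t`): for a smooth `φ` with `|φ| ≤ B` and `s < r ≤ t`,

  `|∫ φ dν_{x,r;s} − ∫ φ dν_{y,r;s}| ≤ B (π (r − s))^{-1/2} · d_{h(r)}(x, y)`.

Proof: for `B' > B` the smooth function `ψ = (φ + B')/(2B')` takes values in `(0, 1)`, its
propagation is `Φ ∘ f'` with `f'` `(r − s)^{-1/2}`-Lipschitz (`…ofReal_abs_PhiInv_sub_PhiInv_le`
with `T = 0`), `Φ` is `(4π)^{-1/2}`-Lipschitz, and `∫ φ dν = 2B' ∫ ψ dν − B'`; let `B' ↘ B`.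
[cite: Bamler2023, §3.1, Def. 3.2 (6)] -/
theorem IsRicciFlow.ofReal_abs_integral_sub_integral_le {s t : ℝ} (hst : s < t)
    {cov : ℝ → CovariantDerivative I (EuclideanSpace ℝ (Fin m)) (TangentSpace I : M → Type _)}
    (hflow : IsRicciFlow h cov (Icc s t))
    {φ : M → ℝ} (hφ : ContMDiff I 𝓘(ℝ, ℝ) ∞ φ) {B : ℝ} (hB : 0 < B) (hφB : ∀ x, |φ x| ≤ B)
    {r : ℝ} (hr : r ∈ Ioc s t) (x y : M) :
    ENNReal.ofReal |∫ z, φ z ∂(heatKernelMeasure hh hR r x s) -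
        ∫ z, φ z ∂(heatKernelMeasure hh hR r y s)| ≤
      ENNReal.ofReal (B * (1 / Real.sqrt (Real.pi * (r - s)))) * (h r).edist (hR r) x y := by
  have hrs : 0 < r - s := sub_pos.2 hr.1
  have hκ : 0 ≤ 1 / Real.sqrt (Real.pi * (r - s)) := by positivity
  refine ofReal_abs_le_of_forall_gt (mul_pos hB (by positivity)) hκ fun B' hB' ↦ ?_
  have hB'0 : 0 < B' := hB.trans hB'
  -- the rescaled datum `ψ = (φ + B') / (2 B')` with values in `(0, 1)`
  set ψ : M → ℝ := fun z ↦ (φ z + B') / (2 * B') with hψ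
  have hψs : ContMDiff I 𝓘(ℝ, ℝ) ∞ ψ := (hφ.add contMDiff_const).div_const _
  have hψ01 : ∀ z, ψ z ∈ Ioo (0 : ℝ) 1 := by
    intro z
    have h1 := abs_le.1 (hφB z)
    simp only [hψ, mem_Ioo]
    constructor
    · apply div_pos _ (by positivity); linarith
    · rw [div_lt_one (by positivity)]; linarith
  -- the propagations and the affine relation between them
  set Pφ : M → ℝ := fun z ↦ ∫ w, φ w ∂(heatKernelMeasure hh hR r z s)
  set Pψ : M → ℝ := fun z ↦ ∫ w, ψ w ∂(heatKernelMeasure hh hR r z s)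
  have haff : ∀ z, Pφ z = 2 * B' * Pψ z - B' := by
    intro z
    have hφi : Integrable φ (heatKernelMeasure hh hR r z s) :=
      hφ.continuous.integrable_of_hasCompactSupport (HasCompactSupport.of_compactSpace φ)
    have e : Pψ z = (Pφ z + B') / (2 * B') := by
      simp only [Pψ, Pφ, hψ]
      rw [integral_div, integral_add hφi (integrable_const _)]
      simp
    rw [e]
    field_simp
    ring
  -- `Φ⁻¹ ∘ Pψ` is `(r - s)^{-1/2}`-Lipschitz, `Φ` is `(4π)^{-1/2}`-Lipschitz
  have hPψ01 : ∀ z, Pψ z ∈ Ioo (0 : ℝ) 1 := by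
    intro z
    obtain ⟨a, b, ha, hb, hab⟩ := exists_Icc_subset_Ioo_of_continuous hψs.continuous hψ01
    have hz := integral_heatKernelMeasure_mem_Icc hh hR r z s hψs.continuous
      (fun w ↦ (hab w).1) (fun w ↦ (hab w).2)
    exact ⟨ha.trans_le hz.1, hz.2.trans_lt hb⟩
  have hLip := hflow.ofReal_abs_PhiInv_sub_PhiInv_le hh hR hst hψs hψ01 le_rfl
    (fun z ↦ by simp) ⟨hr.1.le, hr.2⟩ (by linarith) x y
  simp only [zero_add] at hLip
  -- `Φ` is `(4π)^{-1/2}`-Lipschitz (mean value inequality; cf. `MetricFlow.abs_Phi_sub_Phi_le`)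
  have hΦlip : ∀ a b : ℝ, |Phi a - Phi b| ≤ (Real.sqrt (4 * Real.pi))⁻¹ * |a - b| := by
    intro a b
    have hderiv : ∀ x, ‖deriv Phi x‖ ≤ (Real.sqrt (4 * Real.pi))⁻¹ := by
      intro x
      rw [deriv_Phi, Real.norm_eq_abs, abs_of_nonneg (by positivity)]
      have : Real.exp (-x ^ 2 / 4) ≤ 1 := Real.exp_le_one_iff.2 (by nlinarith [sq_nonneg x])
      simpa only [mul_one] using mul_le_mul_of_nonneg_left this (by positivity)
    have key := Convex.norm_image_sub_le_of_norm_deriv_le (s := univ)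
      (fun x _ ↦ differentiable_Phi x) (fun x _ ↦ hderiv x) convex_univ (mem_univ b) (mem_univ a)
    rw [Real.norm_eq_abs, Real.norm_eq_abs] at key
    exact key
  -- combine
  have hΦ := hΦlip (PhiInv (Pψ x)) (PhiInv (Pψ y))
  rw [Phi_PhiInv (hPψ01 x).1 (hPψ01 x).2, Phi_PhiInv (hPψ01 y).1 (hPψ01 y).2] at hΦ
  have hdiff : Pφ x - Pφ y = 2 * B' * (Pψ x - Pψ y) := by rw [haff x, haff y]; ring
  have habs : |Pφ x - Pφ y| = 2 * B' * |Pψ x - Pψ y| := by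
    rw [hdiff, abs_mul, abs_of_pos (by positivity)]
  -- constants: `2 B' (4π)^{-1/2} (r - s)^{-1/2} = B' (π (r - s))^{-1/2}`
  have hconst : 2 * B' * (Real.sqrt (4 * Real.pi))⁻¹ * (1 / Real.sqrt (r - s)) =
      B' * (1 / Real.sqrt (Real.pi * (r - s))) := by
    have h4 : Real.sqrt (4 * Real.pi) = 2 * Real.sqrt Real.pi := by
      rw [Real.sqrt_mul (by norm_num), show Real.sqrt 4 = 2 by
        rw [show (4 : ℝ) = 2 ^ 2 by norm_num, Real.sqrt_sq (by norm_num)]]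
    rw [h4, Real.sqrt_mul Real.pi_pos.le]
    have hπ : Real.sqrt Real.pi ≠ 0 := (Real.sqrt_pos.2 Real.pi_pos).ne'
    have hrs' : Real.sqrt (r - s) ≠ 0 := (Real.sqrt_pos.2 hrs).ne'
    field_simp
  show ENNReal.ofReal |Pφ x - Pφ y| ≤ _
  calc ENNReal.ofReal |Pφ x - Pφ y|
      = ENNReal.ofReal (2 * B') * ENNReal.ofReal |Pψ x - Pψ y| := by
        rw [habs, ENNReal.ofReal_mul (by positivity)]
    _ ≤ ENNReal.ofReal (2 * B') *
          (ENNReal.ofReal ((Real.sqrt (4 * Real.pi))⁻¹) *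
            ENNReal.ofReal |PhiInv (Pψ x) - PhiInv (Pψ y)|) := by
        gcongr
        rw [← ENNReal.ofReal_mul (by positivity)]
        exact ENNReal.ofReal_le_ofReal hΦ
    _ ≤ ENNReal.ofReal (2 * B') *
          (ENNReal.ofReal ((Real.sqrt (4 * Real.pi))⁻¹) *
            (ENNReal.ofReal (1 / Real.sqrt (r - s)) * (h r).edist (hR r) x y)) := by
        gcongr
    _ = ENNReal.ofReal (B' * (1 / Real.sqrt (Real.pi * (r - s)))) * (h r).edist (hR r) x y := by
        rw [← mul_assoc, ← mul_assoc, ← ENNReal.ofReal_mul (by positivity),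
          ← ENNReal.ofReal_mul (by positivity), hconst]

end HeatKernel

end Literature.Geometry.Riemannian
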